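import Summits.QuantumFields.YangMills.Theorems.BalabanUVNodesN15NeumannCubeLiftDescent
import Summits.QuantumFields.YangMills.Theorems.BalabanUVNodesN15NeumannCubeNonlocalDefect
import HarnessLib

/-!
# Route «BalabanUVNodes» (K3⁷), node N15 = NE2, -a lane, PROGRAMME P file P-IIi: THE η-DEFECT OF THE LIFTED CUBE PROPAGATOR BEHIND `N_L = a•Q*Q − ∂Π∂*` ON THE TORUS FAMILY OF RECORD —
# dag-n15-c WANT-n15-a (g12-4) LIFTED (cube side `L^s` FIXED, volume `2L^{m_T}` FREE): the nonlocal part of `Δ_a` DESCENDS, so N-IIm's row transplants by P-IIf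

Cell `pub-ymgap`, seat `pub-ymgap-dag-n15-a` (KNIT-BY-NAME, g21; D-0062; chair R424 venue; `bears_on: R4∕N15`); `--kind proof --supports stmt-QuantumFields-20544 --as helper`.
Over P-IIf `…NeumannCubeLiftDescent` (★★ `nonlocalRe_comp_pullVR`: `(a•Q*Q − ∂Π∂*)_M ∘ π^* = π^* ∘ (a•Q*Q − ∂Π∂*)_{M′}`; ★★★ `hasMaj_idef_chiCube_comp_liftCubeG_of_comm`: a descending pair's cube-torus
η-defect row transplants to the torus of record with the SAME letter) and N-IIm `…NeumannCubeNonlocalDefect` (★★★ `hasMaj_idef_chiCube_nonlocal_neumannCubeG`: the cube-torus row, hypothesis-free).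
dag-n15-c g12 I.31964: «its lift to the torus of record can wait» — it costs one transplant, so here it is, for FILE 73's record knit (`knitGR … := liftCubeG …`).

WHAT.  ★★★ `hasMaj_idef_chiCube_nonlocal_liftCubeG`: for odd `L ≥ 3`, `a > 0`, `0 < γ < 1` there are `δ, m > 0` (N-IIm's) such that for EVERY cube exponent `s`, volume exponent `m_T ≥ s`, coarse
level `k ≥ 1`, refinement `r` and corner `c` of the torus of record `M = MP (paramsOf d L m_T k hL)` (`M_ν = 2L^{m_T}`; cube torus `MP (paramsOf d L s k hL)`, `liftCubeG … (MP_dvd_MP hL hs k) c (L^s) a`):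
`𝔇(χ′_□∘(a•Q*′Q′ − V′)∘G′^{↑}(□ + c), χ_□∘(a•Q*Q − V)∘G^{↑}(□ + c)) ≤ 1_□(y)1_□(y′)·m·(L^k)^{−γ∕2}·e^{−δ|y−y′|_T}` — UNIFORM in the volume `m_T`.  (FILE 73's cube side `L^{s+1}` is `s := s+1`.)
HONEST FRAMING.  A transplant of a LANDED row (no new estimate); `U ≡ 1` torus MODEL of [B5] §1; the multi-cube gluing on the torus of record is dag-n15-c's FILE 73; nothing of [B6] (2.38)–(2.40) ∕ [B9]
Thm 3.14 asserted; N15 NOT discharged (object-bound; NE2⁺ NOT PRINTED); counts UNMOVED (typed 28∕28 · discharged 5∕27); finite tori per index — NOT continuum ∕ ℝ⁴ ∕ OS ∕ mass gap ∕ Clay.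
Theorems only (0 def).
-/

noncomputable section

open scoped BigOperators Matrix
open Finset

namespace Summit.QuantumFields.YangMills.BalabanUVNodes.N15.TwoGrid

open Literature.MathematicalPhysics.QuantumFieldTheory.Balaban1983to89
open Literature.MathematicalPhysics.QuantumFieldTheory.Balaban1983to89.B5Prop11Plancherel (Tor fine unitVec)
open Literature.MathematicalPhysics.QuantumFieldTheory.Balaban1983to89.B5SiteBridgeP12 (MP)
open Literature.MathematicalPhysics.QuantumFieldTheory.Balaban1983to89.B6Prop26Gluing (mulOp mulOp_apply ind ind_nonneg ind_le_one)
open Literature.MathematicalPhysics.QuantumFieldTheory.King1986.Torus (blockOf tdistT)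
open Literature.MathematicalPhysics.QuantumFieldTheory.Balaban1983to89.B11SectG (BlockNorm HasMaj)
open Literature.MathematicalPhysics.QuantumFieldTheory.Balaban1983to89.B6UnitTorusCarrier (unitTorusGeo)
open Literature.MathematicalPhysics.QuantumFieldTheory.Balaban1983to89.T4EtaRateDefect (idef)
open Literature.MathematicalPhysics.QuantumFieldTheory.Balaban1983to89.T4EtaRateCoeffDefect (pull pull_apply)
open Summit.QuantumFields.YangMills.BalabanUVNodes.N15.VectorPiece (kingPr kingPrV blkFine)

variable {d : ℕ}

/-! ## §42 WANT-n15-a (g12-4) on the torus family of record -/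

section Family

variable {L : ℕ} [NeZero L]

/-- ★★★ **THE η-DEFECT OF THE LIFTED CUBE PROPAGATOR BEHIND THE NONLOCAL PART OF `Δ_a` ON THE TORUS FAMILY OF RECORD, HYPOTHESIS-FREE, UNIFORM IN THE VOLUME**: for odd `L ≥ 3`, `a > 0`,
`0 < γ < 1` there are `δ, m > 0` such that for every `s ≤ m_T`, `k ≥ 1`, `r`, corner `c` of `Tor (MP (paramsOf d L m_T k hL))`:
`𝔇(χ′_□∘(a•Q*′Q′ − V′)∘G′^{↑}(□ + c), χ_□∘(a•Q*Q − V)∘G^{↑}(□ + c)) ≤ 1_□(y)1_□(y′)·m·(L^k)^{−γ∕2}·e^{−δ|y−y′|_T}` — N-IIm's cube-torus row (torus `2L^s`, cube side `L^s`, image corner `π̃c`)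
transplanted by P-IIf (`N_L` descends along `π^*`: `nonlocalRe_comp_pullVR`).
[cite: Balaban1985BackgroundPropagators, Thm 3.14 pp.426–427 (difference template), (3.42) p.397 (shape); Balaban1984PropagatorsII, p.238 (T_□), (2.90)–(2.91) p.239, (2.133)–(2.134) p.247,
(2.37) p.229; Balaban1984PropagatorsI, (1.18) p.20, (1.69)–(1.70) pp.29–30, Prop. 1.2 (1.110) p.35, (1.126) p.38; King1986, p.664] -/
theorem hasMaj_idef_chiCube_nonlocal_liftCubeG (hLodd : Odd L) (hL2 : 2 ≤ L) {a : ℝ} (ha : 0 < a) {γ : ℝ} (hγ0 : 0 < γ) (hγ1 : γ < 1) :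
    ∃ δ m : ℝ, 0 < δ ∧ 0 < m ∧ ∀ (s mT k r : ℕ) (hk : 1 ≤ k) (hL : Odd L ∧ 1 < L) (hs : s ≤ mT) (c : Tor (MP (paramsOf d L mT k hL))),
      HasMaj (BlockNorm.ofBlocks (unitTorusGeo L k (MP (paramsOf d L mT k hL))) (blkFine L k (MP (paramsOf d L mT k hL))))
        (BlockNorm.ofBlocks (unitTorusGeo L k (MP (paramsOf d L mT k hL)))
          (fun i : Tor (fine (L ^ r * L ^ k) (MP (paramsOf d L mT k hL))) × Fin (d + 1) => blockOf (L ^ r * L ^ k) (MP (paramsOf d L mT k hL)) i.1))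
        (idef (pull (kingPrV L k r (MP (paramsOf d L mT k hL)))) (pull (kingPrV L k r (MP (paramsOf d L mT k hL))))
          (mulOp (chiCube (MP (paramsOf d L mT k hL)) (L ^ r * L ^ k) c (L ^ s)) ∘ₗ
            ((a • (qvAdjRe (MP (paramsOf d L mT k hL)) (L ^ r * L ^ k) ∘ₗ qvRe (MP (paramsOf d L mT k hL)) (L ^ r * L ^ k)) +
                (-landauRe (MP (paramsOf d L mT k hL)) (L ^ r * L ^ k))) ∘ₗ
              liftCubeG (L ^ r * L ^ k) (MP_dvd_MP hL hs k) c (L ^ s) a))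
          (mulOp (chiCube (MP (paramsOf d L mT k hL)) (L ^ k) c (L ^ s)) ∘ₗ
            ((a • (qvAdjRe (MP (paramsOf d L mT k hL)) (L ^ k) ∘ₗ qvRe (MP (paramsOf d L mT k hL)) (L ^ k)) + (-landauRe (MP (paramsOf d L mT k hL)) (L ^ k))) ∘ₗ
              liftCubeG (L ^ k) (MP_dvd_MP hL hs k) c (L ^ s) a)))
        (fun y y' => ind ((cubeBlocks (MP (paramsOf d L mT k hL)) c (L ^ s) : Finset _) : Set _) y *
          ind ((cubeBlocks (MP (paramsOf d L mT k hL)) c (L ^ s) : Finset _) : Set _) y' *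
          (m * ((L ^ k : ℕ) : ℝ) ^ (-(γ / 2)) * Real.exp (-(δ * tdistT (MP (paramsOf d L mT k hL)) y y')))) := by
  obtain ⟨δ, m, hδ, hm, H⟩ := hasMaj_idef_chiCube_nonlocal_neumannCubeG (d := d) hLodd hL2 ha hγ0 hγ1
  refine ⟨δ, m, hδ, hm, fun s mT k r hk hL hs c => ?_⟩
  have hρ : 0 ≤ m * ((L ^ k : ℕ) : ℝ) ^ (-(γ / 2)) := mul_nonneg hm.le (Real.rpow_nonneg (Nat.cast_nonneg _) _)
  exact hasMaj_idef_chiCube_comp_liftCubeG_of_comm (d := d) hL (r := r) hs c a (nonlocalRe_comp_pullVR (L ^ k) (MP_dvd_MP hL hs k) a)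
    (nonlocalRe_comp_pullVR (L ^ r * L ^ k) (MP_dvd_MP hL hs k) a) hρ (H s k r hk hL (L ^ s) (fun _ => rfl) (torRed (MP_dvd_MP hL hs k) c))

end Family

end Summit.QuantumFields.YangMills.BalabanUVNodes.N15.TwoGrid
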